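import Mathlib
import HarnessLib
import Literature.AlgebraicGeometry.Kloosterman2025.ExcessTangentDimensionLowerBound

/-!
# HodgeLocusCensusExcessLowerBound451632 — the Kloosterman lower bounds `e ≥ 1` on census cell (4,5,1) and `e ≥ 2` on cell (6,3,2), for every hypersurface of the cell and every λ (cell pub-hlocus, ENGINE B seat ivhs-2, gen 20)
HONEST FRAMING: certified instances and evidence bearing on the general Hodge conjecture; no claim.

These are the two cell-specific EVALUATIONS of the tree's general inequality
`Literature.AlgebraicGeometry.Kloosterman2025.twoPlanes_finrank_inf_add_ciHilbert_le` /
`twoPlanes_idealDegree_inf_lt` (Kloosterman 2025, Theorem 1.3 / Example 3.16, lower bound) that the census records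
`pub-hlocus-ivhs-2/MU0451-g20.md` (M-451: `μ₀(4,5,1; λ) = 2` for all `λ ∉ {0,1}`) and `pub-hlocus-ivhs-2/MU0B2-g18.md` (M-632) use as
their LOWER-BOUND input; neither cell is a row of the tree's `census_cells_bounds`, so the arithmetic and the corollaries are
recorded here, in the style of `cubicEightfold_twoFourPlanes_line_idealDegree_inf_lt` (cell (8,3,1)).

* Cell (4,5,1): quintic fourfolds (`d = 5`) through two `2`-planes in `ℙ⁵` meeting along a line (`k = 2`, `c = 1`, `r = 2`);
  `h_{I₁+I₂} = ciHilbert(4,4)`, `(α, β) = (d, kd−2k−2) = (5, 4)`: `h(4) = 3 > h(5) = 2`, so for EVERY `F` in normal form with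
  finite-dimensional Jacobian ring, every socle functional `ℓ` and EVERY `c₀`: `dim (I₁∩I₂)₅ + 1 ≤ dim I(ℓ₁ + c₀ℓ₂)₅`
  (excess tangent dimension `e(X; c₀) ≥ 1`) and in particular `(I₁ ∩ I₂)₅ ⊊ I(ℓ₁ + c₀ℓ₂)₅`.
* Cell (6,3,2): cubic sixfolds (`d = 3`) through two `3`-planes in `ℙ⁷` meeting in a plane (`k = 3`, `c = 1`, `r = 3`);
  `h_{I₁+I₂} = ciHilbert(2,2,2)`, `(α, β) = (3, 1)`: `h(1) = 3 > h(3) = 1`, so `dim (I₁∩I₂)₃ + 2 ≤ dim I(ℓ₁ + c₀ℓ₂)₃` (`e ≥ 2`).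

What is NOT formalised here is exactly what is not formalised in the Literature file (the identification of these graded
pieces with tangent spaces of Noether–Lefschetz / Hodge loci, cited there), and the census UPPER bounds (certificates of the records).
-/

noncomputable section

open MvPolynomial Module Literature.RingTheory.MvPolynomial
open Literature.AlgebraicGeometry.HodgeTheory Literature.AlgebraicGeometry.Motives.UniversalHypersurface
  Literature.AlgebraicGeometry.Kloosterman2023 Literature.AlgebraicGeometry.Kloosterman2025

namespace Summit.HodgeConjecture.HodgeConjecture.HodgeLocus.Census.ExcessLowerBound

variable {K : Type*} [Field K]

/-- The arithmetic of cell (4,5,1): `h_{I₁+I₂} = ciHilbert(4,4)` takes the values `h(4) = 3`, `h(5) = 2`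
(monomials `aᵢbʲ`, `i, j ≤ 3`, of degree 4 resp. 5). -/
theorem ciHilbert_44_at_4_and_5 :
    ciHilbert (List.replicate 2 4) 4 = 3 ∧ ciHilbert (List.replicate 2 4) 5 = 2 := by
  decide

/-- The arithmetic of cell (6,3,2): `h_{I₁+I₂} = ciHilbert(2,2,2)` takes the values `h(1) = 3`, `h(3) = 1`. -/
theorem ciHilbert_222_at_1_and_3 :
    ciHilbert (List.replicate 3 2) 1 = 3 ∧ ciHilbert (List.replicate 3 2) 3 = 1 := by
  decide

/-- **Census cell (4,5,1) — two 2-planes in a quintic fourfold meeting along a line** (`d = 5`, `k = 2`, `c = 1`, `r = 2`;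
`(α, β) = (5, 4)`): for EVERY quintic `F` in Kloosterman's normal form in `x_0,…,x_5` with finite-dimensional Jacobian ring
(witnessed by `xₗ^N ∈ J^F`), every socle functional `ℓ` of `J^F` and EVERY `c₀ ∈ K`,
`(I(Π₁) ∩ I(Π₂))₅ ⊊ I(ℓ₁ + c₀ℓ₂)₅` — the census input "`e(X; λ) ≥ 1` for every `X ∈ NL(pair)` and every `λ`" of record MU0451-g20
(evaluation of Kloosterman 2025, Theorem 1.3 / Example 3.16 at `(d, c, k) = (5, 1, 2)`). -/
theorem quinticFourfold_twoPlanes_line_idealDegree_inf_lt (κ : Fin 1 ⊕ Fin 2 ≃ Fin (2 + 1))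
    (gA h : Fin 1 → MvPolynomial (Fin (2 * 2 + 2)) K) (gC : Fin 2 → MvPolynomial (Fin (2 * 2 + 2)) K)
    (Q : Fin 1 → Fin 1 → MvPolynomial (Fin (2 * 2 + 2)) K) (P : Fin 2 → MvPolynomial (Fin (2 * 2 + 2)) K)
    (hgA : ∀ i, (gA i).IsHomogeneous 1) (hh : ∀ j, (h j).IsHomogeneous 1) (hgC : ∀ m, (gC m).IsHomogeneous 1)
    (hQ : ∀ i j, (Q i j).IsHomogeneous 3) (hP : ∀ m, (P m).IsHomogeneous 4) {N : ℕ} (hN : 0 < N)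
    (hXN : ∀ l, (X l : MvPolynomial (Fin (2 * 2 + 2)) K) ^ N ∈ jacobianIdeal (twoPlanesForm gA h gC Q P))
    {ℓ : MvPolynomial (Fin (2 * 2 + 2)) K →ₗ[K] K} (hℓ : ∀ p, ℓ (homogeneousComponent 18 p) = ℓ p)
    (hJ : annIdeal ℓ = jacobianIdeal (twoPlanesForm gA h gC Q P)) (c₀ : K) :
    idealDegree
        ((Ideal.span (Set.range (plane₁Gens κ gA gC)) ⊔ Ideal.span (Set.range (plane₁Cofs κ h Q P))) ⊓
          (Ideal.span (Set.range (plane₂Gens κ h gC)) ⊔ Ideal.span (Set.range (plane₂Cofs κ gA Q P)))) 5 <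
      idealDegree (annIdeal (ciCycleFunctional ℓ (plane₁Gens κ gA gC) (plane₁Cofs κ h Q P) +
        c₀ • ciCycleFunctional ℓ (plane₂Gens κ h gC) (plane₂Cofs κ gA Q P))) 5 :=
  twoPlanes_idealDegree_inf_lt (d := 5) (by norm_num) κ gA h gC Q P hgA hh hgC hQ hP hN hXN hℓ hJ
    (α := 5) (β := 4) (by norm_num) (by decide) c₀

/-- **Census cell (4,5,1), quantitative form**: `dim (I(Π₁) ∩ I(Π₂))₅ + 1 ≤ dim ker_L((φ₁ + c₀φ₂)|_{S₅×S₄})` (`= dim I(ℓ₁ + c₀ℓ₂)₅`),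
i.e. excess tangent dimension `e(X; c₀) ≥ h(4) − h(5) = 3 − 2 = 1` for every `X` of the cell and every `c₀`
(evaluation of `twoPlanes_finrank_inf_add_ciHilbert_le`). -/
theorem quinticFourfold_twoPlanes_line_finrank_inf_add_one_le (κ : Fin 1 ⊕ Fin 2 ≃ Fin (2 + 1))
    (gA h : Fin 1 → MvPolynomial (Fin (2 * 2 + 2)) K) (gC : Fin 2 → MvPolynomial (Fin (2 * 2 + 2)) K)
    (Q : Fin 1 → Fin 1 → MvPolynomial (Fin (2 * 2 + 2)) K) (P : Fin 2 → MvPolynomial (Fin (2 * 2 + 2)) K)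
    (hgA : ∀ i, (gA i).IsHomogeneous 1) (hh : ∀ j, (h j).IsHomogeneous 1) (hgC : ∀ m, (gC m).IsHomogeneous 1)
    (hQ : ∀ i j, (Q i j).IsHomogeneous 3) (hP : ∀ m, (P m).IsHomogeneous 4) {N : ℕ} (hN : 0 < N)
    (hXN : ∀ l, (X l : MvPolynomial (Fin (2 * 2 + 2)) K) ^ N ∈ jacobianIdeal (twoPlanesForm gA h gC Q P))
    {ℓ : MvPolynomial (Fin (2 * 2 + 2)) K →ₗ[K] K} (hℓ : ∀ p, ℓ (homogeneousComponent 18 p) = ℓ p)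
    (hJ : annIdeal ℓ = jacobianIdeal (twoPlanesForm gA h gC Q P)) (c₀ : K) :
    finrank K (idealDegree
        ((Ideal.span (Set.range (plane₁Gens κ gA gC)) ⊔ Ideal.span (Set.range (plane₁Cofs κ h Q P))) ⊓
          (Ideal.span (Set.range (plane₂Gens κ h gC)) ⊔ Ideal.span (Set.range (plane₂Cofs κ gA Q P)))) 5) + 1 ≤
      finrank K (LinearMap.ker (gradedMulForm
        (ciCycleFunctional ℓ (plane₁Gens κ gA gC) (plane₁Cofs κ h Q P) +
          c₀ • ciCycleFunctional ℓ (plane₂Gens κ h gC) (plane₂Cofs κ gA Q P)) 5 4)) := by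
  have hmain := twoPlanes_finrank_inf_add_ciHilbert_le (d := 5) (by norm_num) κ gA h gC Q P hgA hh hgC hQ hP hN
    hXN hℓ hJ (α := 5) (β := 4) (by norm_num) c₀
  have h4 : ciHilbert (List.replicate 2 (5 - 1)) 4 = 3 := by decide
  have h5 : ciHilbert (List.replicate 2 (5 - 1)) 5 = 2 := by decide
  rw [h4, h5] at hmain
  omega

/-- **Census cell (6,3,2) — two 3-planes in a cubic sixfold meeting in a plane** (`d = 3`, `k = 3`, `c = 1`, `r = 3`;
`(α, β) = (3, 1)`, `h_{I₁+I₂} = ciHilbert(2,2,2)`: `h(1) = 3 > h(3) = 1`): for EVERY cubic `F` in normal form in `x_0,…,x_7`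
with finite-dimensional Jacobian ring, every socle functional `ℓ` of `J^F` and EVERY `c₀ ∈ K`,
`(I(Π₁) ∩ I(Π₂))₃ ⊊ I(ℓ₁ + c₀ℓ₂)₃` (Theorem 1.3 / Example 3.16 at `(d, c, k) = (3, 1, 3)`). -/
theorem cubicSixfold_twoThreePlanes_plane_idealDegree_inf_lt (κ : Fin 1 ⊕ Fin 3 ≃ Fin (3 + 1))
    (gA h : Fin 1 → MvPolynomial (Fin (2 * 3 + 2)) K) (gC : Fin 3 → MvPolynomial (Fin (2 * 3 + 2)) K)
    (Q : Fin 1 → Fin 1 → MvPolynomial (Fin (2 * 3 + 2)) K) (P : Fin 3 → MvPolynomial (Fin (2 * 3 + 2)) K)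
    (hgA : ∀ i, (gA i).IsHomogeneous 1) (hh : ∀ j, (h j).IsHomogeneous 1) (hgC : ∀ m, (gC m).IsHomogeneous 1)
    (hQ : ∀ i j, (Q i j).IsHomogeneous 1) (hP : ∀ m, (P m).IsHomogeneous 2) {N : ℕ} (hN : 0 < N)
    (hXN : ∀ l, (X l : MvPolynomial (Fin (2 * 3 + 2)) K) ^ N ∈ jacobianIdeal (twoPlanesForm gA h gC Q P))
    {ℓ : MvPolynomial (Fin (2 * 3 + 2)) K →ₗ[K] K} (hℓ : ∀ p, ℓ (homogeneousComponent 8 p) = ℓ p)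
    (hJ : annIdeal ℓ = jacobianIdeal (twoPlanesForm gA h gC Q P)) (c₀ : K) :
    idealDegree
        ((Ideal.span (Set.range (plane₁Gens κ gA gC)) ⊔ Ideal.span (Set.range (plane₁Cofs κ h Q P))) ⊓
          (Ideal.span (Set.range (plane₂Gens κ h gC)) ⊔ Ideal.span (Set.range (plane₂Cofs κ gA Q P)))) 3 <
      idealDegree (annIdeal (ciCycleFunctional ℓ (plane₁Gens κ gA gC) (plane₁Cofs κ h Q P) +
        c₀ • ciCycleFunctional ℓ (plane₂Gens κ h gC) (plane₂Cofs κ gA Q P))) 3 :=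
  twoPlanes_idealDegree_inf_lt (d := 3) (by norm_num) κ gA h gC Q P hgA hh hgC hQ hP hN hXN hℓ hJ
    (α := 3) (β := 1) (by norm_num) (by decide) c₀

/-- **Census cell (6,3,2), quantitative form**: `dim (I(Π₁) ∩ I(Π₂))₃ + 2 ≤ dim ker_L((φ₁ + c₀φ₂)|_{S₃×S₁})`,
i.e. `e(X; c₀) ≥ h(1) − h(3) = 3 − 1 = 2` for every `X` of the cell and every `c₀` — the census input (F1) of record
MU0B2-g18 (M-632) (evaluation of `twoPlanes_finrank_inf_add_ciHilbert_le`). -/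
theorem cubicSixfold_twoThreePlanes_plane_finrank_inf_add_two_le (κ : Fin 1 ⊕ Fin 3 ≃ Fin (3 + 1))
    (gA h : Fin 1 → MvPolynomial (Fin (2 * 3 + 2)) K) (gC : Fin 3 → MvPolynomial (Fin (2 * 3 + 2)) K)
    (Q : Fin 1 → Fin 1 → MvPolynomial (Fin (2 * 3 + 2)) K) (P : Fin 3 → MvPolynomial (Fin (2 * 3 + 2)) K)
    (hgA : ∀ i, (gA i).IsHomogeneous 1) (hh : ∀ j, (h j).IsHomogeneous 1) (hgC : ∀ m, (gC m).IsHomogeneous 1)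
    (hQ : ∀ i j, (Q i j).IsHomogeneous 1) (hP : ∀ m, (P m).IsHomogeneous 2) {N : ℕ} (hN : 0 < N)
    (hXN : ∀ l, (X l : MvPolynomial (Fin (2 * 3 + 2)) K) ^ N ∈ jacobianIdeal (twoPlanesForm gA h gC Q P))
    {ℓ : MvPolynomial (Fin (2 * 3 + 2)) K →ₗ[K] K} (hℓ : ∀ p, ℓ (homogeneousComponent 8 p) = ℓ p)
    (hJ : annIdeal ℓ = jacobianIdeal (twoPlanesForm gA h gC Q P)) (c₀ : K) :
    finrank K (idealDegree
        ((Ideal.span (Set.range (plane₁Gens κ gA gC)) ⊔ Ideal.span (Set.range (plane₁Cofs κ h Q P))) ⊓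
          (Ideal.span (Set.range (plane₂Gens κ h gC)) ⊔ Ideal.span (Set.range (plane₂Cofs κ gA Q P)))) 3) + 2 ≤
      finrank K (LinearMap.ker (gradedMulForm
        (ciCycleFunctional ℓ (plane₁Gens κ gA gC) (plane₁Cofs κ h Q P) +
          c₀ • ciCycleFunctional ℓ (plane₂Gens κ h gC) (plane₂Cofs κ gA Q P)) 3 1)) := by
  have hmain := twoPlanes_finrank_inf_add_ciHilbert_le (d := 3) (by norm_num) κ gA h gC Q P hgA hh hgC hQ hP hN
    hXN hℓ hJ (α := 3) (β := 1) (by norm_num) c₀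
  have h1 : ciHilbert (List.replicate 3 (3 - 1)) 1 = 3 := by decide
  have h3 : ciHilbert (List.replicate 3 (3 - 1)) 3 = 1 := by decide
  rw [h1, h3] at hmain
  omega

end Summit.HodgeConjecture.HodgeConjecture.HodgeLocus.Census.ExcessLowerBound
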